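import Summits.NavierStokesRegularity.FluidComputer.PalasekTowerRingPusherDensity
import Literature.Analysis.FluidPDE.CylindricalIntegration

/-!
# The ring pusher, III: THE SIGN OF ITS STRICT-ANCHOR INTEGRAL — for a thin enough pancake ring above the origin,
# `∫ D³Γ(0 − x)(μP_δ x, μP_δ x, c e₃) dx > 0` (the one analytic step of stub D2 `SterileMechanismDoorT`)

Cell `ns-blowup`, seat `ns-blowup-fc-prover-2` (g11; D-0074 GROUP C «BRIDGE SUPPORT»). Route `PalasekTowerBreakdown`
(rev 19), crux stmt-NavierStokesRegularity-20303 `EpisodeBaseT` / heredity pair 20304 · 20305, strategist's line `doormirror`,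
stub D2. Sequel of `PalasekTowerRingPusherDensity` (pointwise: integrand `= μ² c · ringDensity δ ≥ μ² c · ringEnvelope δ`).
LABEL: E–C typing + kernel analysis (theorems only). WHAT THIS IS NOT: not Navier–Stokes evidence — a sign computation for
the far-field pressure number of ONE explicit compactly supported profile; no flow, stage, schedule or certificate.

For the ring pusher `α = −f(s) η′(t)/δ`, `β = 2 (f + s f′)(s) η(t)`, `t = (x₂ − 5)/δ`, both terms of the envelope
`c_lo s α² − c_hi β²` SEPARATE in cylindrical coordinates (`Literature…integrable_and_integral_fun_cylRadius_mul`,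
`dx = r dr dθ dz`), and the substitution `z = 5 + δ t` gives

  `∫ ringEnvelope δ = c_lo K₁ ‖η′‖₂² / δ − c_hi K₂ ‖η‖₂² δ`, `K₁ = c₂ ∫₀^∞ ρ³ f(ρ²)² dρ ≥ c₂ (5/8)³/8 > 0`, `‖η′‖₂² > 0`,

positive for `δ = min (1/4) (A/(B + 1))`. Main theorem **`exists_ringPusher_anchor_integral_pos`**: there is `δ ∈ (0, 1/4]`
such that for every `μ ≠ 0` and `c > 0`, `0 < ∫ D³Γ(0 − x)((μ • ringPusher δ) x, (μ • ringPusher δ) x, c • e₃) dx` — the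
strict anchor face of a blob-plus-ring-pusher carrier (sequel `PalasekTowerSterileCarrierAt`).

References: A. J. Majda, A. L. Bertozzi (CUP 2002) §1.8 Prop. 1.16 [cite: MajdaBertozziCUP2002, §1.8 Prop. 1.16]; G. Koch,
N. Nadirashvili, G. Seregin, V. Šverák, Acta Math. 203 (2009), proof of Thm 5.3 (cylindrical integration)
[cite: KochNadirashviliSereginSverak2009, proof of Thm 5.3, (5.19) (arXiv p. 10)]; D. Gilbarg, N. S. Trudinger (2001), (2.13)
[cite: GilbargTrudinger2001, (2.13)].
-/

noncomputable section

namespace Summit.NavierStokesRegularity.FluidComputer.PalasekTowerClayBridge.Germ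

open Set Function Filter Topology InnerProductSpace Metric MeasureTheory Real
open scoped Topology ContDiff RealInnerProductSpace

open Literature.Analysis.FluidPDE TinyBlob

-- nested operator types `ℝ³ →L[ℝ] ℝ³ →L[ℝ] ℝ` (third derivatives of the Newtonian kernel)
set_option maxSynthPendingDepth 3

/-! ## §1 The two separable integrals -/

/-- The radial weight of the positive term: `h₁(ρ) = ρ² f(ρ²)²`, so that `h₁(r) = s f(s)²`. [folklore] -/
theorem hsq_mul_ringAlpha_sq_eq (δ : ℝ) (x : EuclideanSpace ℝ (Fin 3)) :
    hsq x * ringAlpha δ x ^ 2 =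
      (cylRadius x ^ 2 * ringRad (cylRadius x ^ 2) ^ 2) * (deriv ringAx ((x 2 - 5) / δ) ^ 2 / δ ^ 2) := by
  rw [cylRadius_sq, ← hsq, ringAlpha]
  ring

/-- The radial weight of the negative term: `h₂(ρ) = 4 (f(ρ²) + ρ² f′(ρ²))²`. [folklore] -/
theorem ringBeta_sq_eq (δ : ℝ) (x : EuclideanSpace ℝ (Fin 3)) :
    ringBeta δ x ^ 2 =
      (4 * (ringRad (cylRadius x ^ 2) + cylRadius x ^ 2 * deriv ringRad (cylRadius x ^ 2)) ^ 2) *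
        ringAx ((x 2 - 5) / δ) ^ 2 := by
  rw [cylRadius_sq, ← hsq, ringBeta]
  ring

/-- For `|ρ| > 1` the radial profile and its derivative vanish at `ρ²`. [folklore] -/
theorem ringRad_sq_eq_zero_of_one_lt {ρ : ℝ} (h : 1 < |ρ|) : ringRad (ρ ^ 2) = 0 ∧ deriv ringRad (ρ ^ 2) = 0 :=
  ringRad_and_deriv_eq_zero_of_gt (by nlinarith [sq_abs ρ, abs_nonneg ρ])

/-- The positive radial integral is finite: `ρ ↦ ρ · ρ² f(ρ²)²` is integrable on `(0, ∞)`. [folklore] -/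
theorem integrableOn_radial_pos :
    IntegrableOn (fun ρ : ℝ => ρ * (ρ ^ 2 * ringRad (ρ ^ 2) ^ 2)) (Ioi 0) := by
  have hc : Continuous fun ρ : ℝ => ρ * (ρ ^ 2 * ringRad (ρ ^ 2) ^ 2) := by
    have := contDiff_ringRad.continuous; fun_prop
  have hK : HasCompactSupport fun ρ : ℝ => ρ * (ρ ^ 2 * ringRad (ρ ^ 2) ^ 2) := by
    refine HasCompactSupport.intro (isCompact_Icc : IsCompact (Icc (-1 : ℝ) 1)) fun ρ hρ => ?_
    have h : 1 < |ρ| := by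
      rw [mem_Icc, not_and_or, not_le, not_le] at hρ
      rcases hρ with h | h
      · rw [abs_of_neg (by linarith)]; linarith
      · rw [abs_of_pos (by linarith)]; exact h
    simp [(ringRad_sq_eq_zero_of_one_lt h).1]
  exact (hc.integrable_of_hasCompactSupport hK).integrableOn

/-- The negative radial integral is finite. [folklore] -/
theorem integrableOn_radial_neg :
    IntegrableOn (fun ρ : ℝ => ρ * (4 * (ringRad (ρ ^ 2) + ρ ^ 2 * deriv ringRad (ρ ^ 2)) ^ 2)) (Ioi 0) := by
  have hc : Continuous fun ρ : ℝ => ρ * (4 * (ringRad (ρ ^ 2) + ρ ^ 2 * deriv ringRad (ρ ^ 2)) ^ 2) := by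
    have := contDiff_ringRad.continuous; have := continuous_deriv_ringRad; fun_prop
  have hK : HasCompactSupport fun ρ : ℝ => ρ * (4 * (ringRad (ρ ^ 2) + ρ ^ 2 * deriv ringRad (ρ ^ 2)) ^ 2) := by
    refine HasCompactSupport.intro (isCompact_Icc : IsCompact (Icc (-1 : ℝ) 1)) fun ρ hρ => ?_
    have h : 1 < |ρ| := by
      rw [mem_Icc, not_and_or, not_le, not_le] at hρ
      rcases hρ with h | h
      · rw [abs_of_neg (by linarith)]; linarith
      · rw [abs_of_pos (by linarith)]; exact h
    obtain ⟨h1, h2⟩ := ringRad_sq_eq_zero_of_one_lt h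
    simp [h1, h2]
  exact (hc.integrable_of_hasCompactSupport hK).integrableOn

/-- **The positive radial constant is positive**: `∫₀^∞ ρ³ f(ρ²)² dρ ≥ (5/8)³ · (1/8) > 0` (on `[5/8, 3/4]` one has
`ρ² ∈ [3/8, 5/8]`, so `f(ρ²) = 1`). [folklore] -/
theorem radial_pos_integral_pos : 0 < ∫ ρ in Ioi (0 : ℝ), ρ * (ρ ^ 2 * ringRad (ρ ^ 2) ^ 2) := by
  set F : ℝ → ℝ := fun ρ => ρ * (ρ ^ 2 * ringRad (ρ ^ 2) ^ 2) with hF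
  have hFnn : ∀ ρ, 0 ≤ ρ → 0 ≤ F ρ := fun ρ hρ => by rw [hF]; positivity
  have hsub : Icc (5 / 8 : ℝ) (3 / 4) ⊆ Ioi 0 := fun ρ hρ => lt_of_lt_of_le (by norm_num) hρ.1
  have h1 : ∫ ρ in Icc (5 / 8 : ℝ) (3 / 4), F ρ ≤ ∫ ρ in Ioi (0 : ℝ), F ρ :=
    setIntegral_mono_set integrableOn_radial_pos
      ((ae_restrict_iff' measurableSet_Ioi).2 (Eventually.of_forall fun ρ hρ => hFnn ρ (le_of_lt hρ)))
      (Eventually.of_forall hsub)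
  have h2 : ∫ _ in Icc (5 / 8 : ℝ) (3 / 4), ((5 / 8 : ℝ) ^ 3) ≤ ∫ ρ in Icc (5 / 8 : ℝ) (3 / 4), F ρ := by
    refine setIntegral_mono_on (integrableOn_const (by simp)) (integrableOn_radial_pos.mono_set hsub)
      measurableSet_Icc fun ρ hρ => ?_
    have hf1 : ringRad (ρ ^ 2) = 1 := ringRad_eq_one (by nlinarith [hρ.1]) (by nlinarith [hρ.1, hρ.2])
    rw [hF]
    simp only [hf1, one_pow, mul_one]
    have : (5 / 8 : ℝ) ^ 3 ≤ ρ ^ 3 := pow_le_pow_left₀ (by norm_num) hρ.1 3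
    nlinarith
  have h3 : ∫ _ in Icc (5 / 8 : ℝ) (3 / 4), ((5 / 8 : ℝ) ^ 3) = (5 / 8 : ℝ) ^ 3 * (1 / 8) := by
    rw [setIntegral_const, Real.volume_real_Icc_of_le (by norm_num), smul_eq_mul]; ring
  have h4 : (0 : ℝ) < (5 / 8 : ℝ) ^ 3 * (1 / 8) := by norm_num
  linarith

/-- The substitution `z = 5 + δ t`: `∫ g((z − 5)/δ) dz = δ ∫ g` for `δ > 0`. [folklore] -/
theorem integral_comp_shift_div {δ : ℝ} (hδ : 0 < δ) (g : ℝ → ℝ) :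
    ∫ z : ℝ, g ((z - 5) / δ) = δ * ∫ t, g t := by
  have h1 : ∫ z : ℝ, g ((z - 5) / δ) = ∫ z : ℝ, g (z / δ) :=
    integral_sub_right_eq_self (fun y => g (y / δ)) 5
  rw [h1, Measure.integral_comp_div g δ, abs_of_pos hδ, smul_eq_mul]

/-- `∫ (η′)² > 0`. [folklore] -/
theorem integral_deriv_ringAx_sq_pos : 0 < ∫ t, deriv ringAx t ^ 2 := by
  obtain ⟨t₀, ht₀⟩ := exists_deriv_ringAx_ne_zero
  exact (continuous_deriv_ringAx.pow 2).integral_pos_of_hasCompactSupport_nonneg_nonzero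
    hasCompactSupport_deriv_ringAx_sq (fun t => sq_nonneg _) (pow_ne_zero 2 ht₀)

/-- **The positive term**: `∫ s α² dx = (K₁/δ) · ∫ (η′)²` with `K₁ = c₂ ∫₀^∞ ρ³ f(ρ²)² dρ`, and integrability.
[cite: KochNadirashviliSereginSverak2009, proof of Thm 5.3, (5.19) (arXiv p. 10)] -/
theorem integral_hsq_mul_ringAlpha_sq {δ : ℝ} (hδ : 0 < δ) :
    Integrable (fun x => hsq x * ringAlpha δ x ^ 2) ∧
      ∫ x, hsq x * ringAlpha δ x ^ 2 =
        (δ * ∫ t, deriv ringAx t ^ 2) / δ ^ 2 *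
          (radialConst₂ * ∫ ρ in Ioi (0 : ℝ), ρ * (ρ ^ 2 * ringRad (ρ ^ 2) ^ 2)) := by
  have hg : Integrable fun z : ℝ => deriv ringAx ((z - 5) / δ) ^ 2 / δ ^ 2 := by
    have h0 : Integrable fun t : ℝ => deriv ringAx t ^ 2 / δ ^ 2 :=
      ((continuous_deriv_ringAx.pow 2).integrable_of_hasCompactSupport hasCompactSupport_deriv_ringAx_sq).div_const _
    exact (h0.comp_div hδ.ne').comp_sub_right 5
  obtain ⟨hint, heq⟩ := integrable_and_integral_fun_cylRadius_mul
    (h := fun ρ => ρ ^ 2 * ringRad (ρ ^ 2) ^ 2) (g := fun z => deriv ringAx ((z - 5) / δ) ^ 2 / δ ^ 2)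
    integrableOn_radial_pos hg
  have hfun : (fun x => hsq x * ringAlpha δ x ^ 2) = fun x : EuclideanSpace ℝ (Fin 3) =>
      (cylRadius x ^ 2 * ringRad (cylRadius x ^ 2) ^ 2) * (deriv ringAx ((x 2 - 5) / δ) ^ 2 / δ ^ 2) :=
    funext fun x => hsq_mul_ringAlpha_sq_eq δ x
  rw [hfun]
  refine ⟨hint, ?_⟩
  have hsub := integral_comp_shift_div hδ (fun t => deriv ringAx t ^ 2)
  rw [heq, integral_div, hsub]

/-- **The negative term**: `∫ β² dx = (δ ∫ η²) · K₂`, and integrability.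
[cite: KochNadirashviliSereginSverak2009, proof of Thm 5.3, (5.19) (arXiv p. 10)] -/
theorem integral_ringBeta_sq {δ : ℝ} (hδ : 0 < δ) :
    Integrable (fun x => ringBeta δ x ^ 2) ∧
      ∫ x, ringBeta δ x ^ 2 =
        (δ * ∫ t, ringAx t ^ 2) *
          (radialConst₂ * ∫ ρ in Ioi (0 : ℝ), ρ * (4 * (ringRad (ρ ^ 2) + ρ ^ 2 * deriv ringRad (ρ ^ 2)) ^ 2)) := by
  have hg : Integrable fun z : ℝ => ringAx ((z - 5) / δ) ^ 2 := by
    have h0 : Integrable fun t : ℝ => ringAx t ^ 2 :=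
      (contDiff_ringAx.continuous.pow 2).integrable_of_hasCompactSupport hasCompactSupport_ringAx_sq
    exact (h0.comp_div hδ.ne').comp_sub_right 5
  obtain ⟨hint, heq⟩ := integrable_and_integral_fun_cylRadius_mul
    (h := fun ρ => 4 * (ringRad (ρ ^ 2) + ρ ^ 2 * deriv ringRad (ρ ^ 2)) ^ 2) (g := fun z => ringAx ((z - 5) / δ) ^ 2)
    integrableOn_radial_neg hg
  have hfun : (fun x => ringBeta δ x ^ 2) = fun x : EuclideanSpace ℝ (Fin 3) =>
      (4 * (ringRad (cylRadius x ^ 2) + cylRadius x ^ 2 * deriv ringRad (cylRadius x ^ 2)) ^ 2) *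
        ringAx ((x 2 - 5) / δ) ^ 2 :=
    funext fun x => ringBeta_sq_eq δ x
  rw [hfun]
  refine ⟨hint, ?_⟩
  have hsub := integral_comp_shift_div hδ (fun t => ringAx t ^ 2)
  rw [heq, hsub]

/-! ## §2 The sign -/

/-- **THE ENVELOPE INTEGRAL**: `∫ ringEnvelope δ = c_lo K₁ J₁ / δ − c_hi K₂ J₂ δ` with the four constants
`K₁ > 0`, `J₁ > 0`, `K₂, J₂` independent of `δ`. [folklore] -/
theorem integral_ringEnvelope {δ : ℝ} (hδ : 0 < δ) :
    ∫ x, ringEnvelope δ x =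
      ringCLo * ((radialConst₂ * ∫ ρ in Ioi (0 : ℝ), ρ * (ρ ^ 2 * ringRad (ρ ^ 2) ^ 2)) *
          (∫ t, deriv ringAx t ^ 2)) / δ -
        ringCHi * ((radialConst₂ * ∫ ρ in Ioi (0 : ℝ), ρ * (4 * (ringRad (ρ ^ 2) + ρ ^ 2 * deriv ringRad (ρ ^ 2)) ^ 2)) *
          (∫ t, ringAx t ^ 2)) * δ := by
  obtain ⟨hi1, he1⟩ := integral_hsq_mul_ringAlpha_sq hδ
  obtain ⟨hi2, he2⟩ := integral_ringBeta_sq hδ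
  unfold ringEnvelope
  rw [integral_sub (hi1.const_mul _) (hi2.const_mul _), integral_const_mul, integral_const_mul, he1, he2]
  field_simp
  ring

/-- **THE SIGN OF THE STRICT-ANCHOR INTEGRAL OF THE RING PUSHER.** There is a thinness `δ ∈ (0, 1/4]` such that for
every amplitude `μ ≠ 0` and every `c > 0`:
`0 < ∫ D³Γ(0 − x)((μ • ringPusher δ) x, (μ • ringPusher δ) x, c • e₃) dx`.
[cite: MajdaBertozziCUP2002, §1.8 Prop. 1.16] [cite: GilbargTrudinger2001, (2.13)] -/
theorem exists_ringPusher_anchor_integral_pos :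
    ∃ δ : ℝ, 0 < δ ∧ δ ≤ 1 / 4 ∧ ∀ μ c : ℝ, μ ≠ 0 → 0 < c →
      0 < ∫ x, fderiv ℝ (fun w => fderiv ℝ (fun w' => fderiv ℝ newtonKernel w' ((μ • ringPusher δ) x)) w
        ((μ • ringPusher δ) x)) ((0 : EuclideanSpace ℝ (Fin 3)) - x) (c • e₃) := by
  -- the constants
  set K₁ : ℝ := radialConst₂ * ∫ ρ in Ioi (0 : ℝ), ρ * (ρ ^ 2 * ringRad (ρ ^ 2) ^ 2) with hK₁
  set J₁ : ℝ := ∫ t, deriv ringAx t ^ 2 with hJ₁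
  set K₂ : ℝ := radialConst₂ * ∫ ρ in Ioi (0 : ℝ), ρ * (4 * (ringRad (ρ ^ 2) + ρ ^ 2 * deriv ringRad (ρ ^ 2)) ^ 2)
    with hK₂
  set J₂ : ℝ := ∫ t, ringAx t ^ 2 with hJ₂
  have hK₁pos : 0 < K₁ := mul_pos radialConst₂_pos radial_pos_integral_pos
  have hJ₁pos : 0 < J₁ := integral_deriv_ringAx_sq_pos
  have hK₂nn : 0 ≤ K₂ :=
    mul_nonneg radialConst₂_pos.le (setIntegral_nonneg measurableSet_Ioi fun ρ hρ => by
      have : 0 < ρ := hρ; positivity)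
  have hJ₂nn : 0 ≤ J₂ := integral_nonneg fun t => sq_nonneg _
  set A : ℝ := ringCLo * (K₁ * J₁) with hA
  set B : ℝ := ringCHi * (K₂ * J₂) with hB
  have hApos : 0 < A := mul_pos ringCLo_pos (mul_pos hK₁pos hJ₁pos)
  have hBnn : 0 ≤ B := mul_nonneg ringCHi_pos.le (mul_nonneg hK₂nn hJ₂nn)
  -- the thinness
  set δ : ℝ := min (1 / 4) (A / (B + 1)) with hδdef
  have hδpos : 0 < δ := lt_min (by norm_num) (div_pos hApos (by linarith))
  have hδ4 : δ ≤ 1 / 4 := min_le_left _ _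
  have hδAB : δ ≤ A / (B + 1) := min_le_right _ _
  refine ⟨δ, hδpos, hδ4, fun μ c hμ hc => ?_⟩
  -- the envelope integral is positive
  have henv : 0 < ∫ x, ringEnvelope δ x := by
    rw [integral_ringEnvelope hδpos]
    show 0 < A / δ - B * δ
    have h1 : B * δ ^ 2 < A := by
      have h2 : B * δ ≤ A := by
        have := (le_div_iff₀ (by linarith : (0 : ℝ) < B + 1)).1 hδAB
        nlinarith
      have h3 : δ ^ 2 ≤ δ * (1 / 4) := by nlinarith
      nlinarith
    rw [sub_pos, lt_div_iff₀ hδpos]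
    nlinarith
  -- the density integral dominates it
  obtain ⟨hcD, hcE⟩ := hasCompactSupport_ringDensity_ringEnvelope hδpos hδ4
  have hdens : 0 < ∫ x, ringDensity δ x :=
    lt_of_lt_of_le henv (integral_mono ((continuous_ringEnvelope δ).integrable_of_hasCompactSupport hcE)
      ((continuous_ringDensity δ).integrable_of_hasCompactSupport hcD)
      (ringEnvelope_le_ringDensity hδpos hδ4))
  have hfun : (fun x => fderiv ℝ (fun w => fderiv ℝ (fun w' => fderiv ℝ newtonKernel w' ((μ • ringPusher δ) x)) w
      ((μ • ringPusher δ) x)) ((0 : EuclideanSpace ℝ (Fin 3)) - x) (c • e₃)) =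
      fun x => μ ^ 2 * c * ringDensity δ x :=
    funext fun x => fderiv3_ringPusher_eq hδpos hδ4 μ c x
  rw [hfun, integral_const_mul]
  exact mul_pos (mul_pos (by positivity) hc) hdens

end Summit.NavierStokesRegularity.FluidComputer.PalasekTowerClayBridge.Germ

end
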